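import Mathlib
import Summits.Parity.GeneralizedHardyLittlewood.Theorems.FordMaynardSieveConst01651SieveConst01651EdgeSet

/-!
# Route `FordMaynardSieveConst01651`, target `SieveConst01651` (stmt-Parity-19185), line `sieve_decomposition`:
# helpers towards `stub_typeIIRegion` — the Type-II region `ℛ = Rset ν x` split into MAIN part and BOUNDARY part,
# in the tree's vocabulary (`…Defs.Rset`, appended 2026-08-31)

`Rset ν x` (non-prime, non-`n^ν`-rough integers of `(x/2, x]`) is the disjoint union of
* the MAIN part `{n : smoothPart n^ν n > 1}` — Ford–Maynard's "`n₁ > 1`", the part treated through (II); and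
* the BOUNDARY part `{n ≥ 2 : smoothPart n^ν n = 1, P⁻(n) ≤ n^ν}` (`P⁻(n) = n^ν`), negligible by `…EdgeSet`;
* (and `n = 1`, present only when `x < 2`).
This file states the split as a sum identity over `Rset` and re-expresses the boundary estimate over `Rset`.

* `mem_Rset_cases` — the trichotomy for `n ∈ Rset ν x`;
* `sum_Rset_eq_main_add_edge` — `∑_{ℛ} F = ∑_{ℛ, n₁ > 1} F + ∑_{ℛ, boundary} F` for `x ≥ 2`;
* `Rset_edge_abs_sum_le` — `∑_{ℛ, boundary} |w H| ≤ C x/(log x)^B` under (I).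

Def-free. Nothing here proves anything about the Parity summit; helpers for the Type-II region stub of one leaf.
-/

open Finset Literature.NumberTheory.Sieve Literature.NumberTheory.Sieve.FordMaynard

namespace Summit.Parity.GeneralizedHardyLittlewood.FordMaynardSieveConst01651SieveConst01651

/-- **Trichotomy on `ℛ`.** For `n ∈ Rset ν x`: `n = 1`, or `smoothPart n^ν n > 1` (main), or `n ≥ 2` with
`smoothPart n^ν n = 1` and `P⁻(n) ≤ n^ν` (boundary). [cite: FordMaynard2024PrimeSieves, Proposition 7.19] -/
theorem mem_Rset_cases {ν x : ℝ} {n : ℕ} (hn : n ∈ Rset ν x) :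
    n = 1 ∨ 1 < smoothPart ((n : ℝ) ^ ν) n ∨
      (2 ≤ n ∧ smoothPart ((n : ℝ) ^ ν) n = 1 ∧ (n.minFac : ℝ) ≤ (n : ℝ) ^ ν) := by
  rw [mem_Rset, mem_window] at hn
  obtain ⟨⟨⟨hn1, _⟩, _⟩, _, hnr⟩ := hn
  by_cases h1 : n = 1
  · exact Or.inl h1
  · have hn2 : 2 ≤ n := by omega
    have hnr' : ¬ IsRough ν n := fun h => hnr ⟨hn2, h⟩
    unfold IsRough at hnr'
    rcases (exists_prime_le_rpow_iff (ν := ν) hn2).mp (not_forall_rpow_lt_iff.mp hnr') with h | h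
    · exact Or.inr (Or.inl h)
    · exact Or.inr (Or.inr ⟨hn2, h⟩)

/-- For `x ≥ 2` the window does not contain `1`. [folklore] -/
theorem two_le_of_mem_window {x : ℝ} (hx : 2 ≤ x) {n : ℕ} (hn : n ∈ window x) : 2 ≤ n := by
  rw [mem_window] at hn
  obtain ⟨⟨hn1, _⟩, hlo⟩ := hn
  by_contra h
  have : n = 1 := by omega
  subst this
  simp at hlo
  linarith

/-- **`∑_ℛ = ∑_{main} + ∑_{boundary}`** (`x ≥ 2`): the main part `smoothPart n^ν n > 1` and the boundary part
`smoothPart = 1 ∧ P⁻(n) ≤ n^ν` partition `Rset ν x`. [cite: FordMaynard2024PrimeSieves, Proposition 7.19 / proof of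
Proposition 7.22 ("`n₁ > 1`")] -/
theorem sum_Rset_eq_main_add_edge {M : Type*} [AddCommMonoid M] {ν x : ℝ} (hx : 2 ≤ x) (F : ℕ → M) :
    ∑ n ∈ Rset ν x, F n =
      ∑ n ∈ (Rset ν x).filter (fun n : ℕ => 1 < smoothPart ((n : ℝ) ^ ν) n), F n +
        ∑ n ∈ (Rset ν x).filter
          (fun n : ℕ => smoothPart ((n : ℝ) ^ ν) n = 1 ∧ (n.minFac : ℝ) ≤ (n : ℝ) ^ ν), F n := by
  classical
  rw [← Finset.sum_filter_add_sum_filter_not (Rset ν x) (fun n : ℕ => 1 < smoothPart ((n : ℝ) ^ ν) n)]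
  congr 1
  refine Finset.sum_congr ?_ fun _ _ => rfl
  ext n
  simp only [Finset.mem_filter]
  constructor
  · rintro ⟨hn, hnot⟩
    refine ⟨hn, ?_⟩
    rcases mem_Rset_cases hn with h1 | hmain | ⟨_, hs, hmin⟩
    · exact absurd (two_le_of_mem_window hx (mem_Rset.mp hn).1) (by omega)
    · exact absurd hmain hnot
    · exact ⟨hs, hmin⟩
  · rintro ⟨hn, hs, _⟩
    exact ⟨hn, by omega⟩

/-- **The boundary part of `ℛ` is negligible** (restating `…EdgeSet.edgeSet_abs_sum_le` over `Rset`): for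
`0 < ν ≤ 1/2` and `g` piecewise constant on the cone there is `C ≥ 0` with
`∑_{n ∈ ℛ, smoothPart = 1, P⁻(n) ≤ n^ν} |w(n) H(n)| ≤ C x/(log x)^B` for all `x ≥ 2`, `B ≥ 0`, `w` satisfying (I) at
level `x^{1/2}`. [cite: FordMaynard2024PrimeSieves, Proposition 7.19 and §1 (I)] -/
theorem Rset_edge_abs_sum_le {ν : ℝ} (hν : 0 < ν) (hν2 : ν ≤ 1 / 2) {g : VecFn} (hpc : IsPiecewiseConstOnCone g) :
    ∃ C : ℝ, 0 ≤ C ∧ ∀ x : ℝ, 2 ≤ x → ∀ B : ℝ, 0 ≤ B → ∀ w : ℕ → ℝ,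
      Literature.Barriers.Parity.FordMaynard.TypeI w x (1 / 2) B →
        ∑ n ∈ (Rset ν x).filter
            (fun n : ℕ => smoothPart ((n : ℝ) ^ ν) n = 1 ∧ (n.minFac : ℝ) ≤ (n : ℝ) ^ ν),
          |w n * Hwt g ν n| ≤ C * x / Real.log x ^ B := by
  classical
  obtain ⟨C, hC0, hC⟩ := edgeSet_abs_sum_le hν hν2 hpc
  refine ⟨C, hC0, fun x hx B hB w hI => ?_⟩
  refine le_trans (Finset.sum_le_sum_of_subset_of_nonneg ?_ fun _ _ _ => abs_nonneg _) (hC x (by linarith) B hB w hI)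
  intro n hn
  rw [Finset.mem_filter] at hn
  obtain ⟨hR, hs, hmin⟩ := hn
  have hw : n ∈ window x := (mem_Rset.mp hR).1
  rw [Finset.mem_filter]
  refine ⟨?_, two_le_of_mem_window hx hw, hs, hmin⟩
  rw [mem_window] at hw
  rw [Finset.mem_filter, Finset.mem_Icc]
  exact ⟨hw.1, hw.2⟩

end Summit.Parity.GeneralizedHardyLittlewood.FordMaynardSieveConst01651SieveConst01651
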